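import Summits.Ventures.PercRepro.GenQFlatLatticeA

/-!
# PercRepro — the flat-lattice counting rows, part C: the demand-free credits by level (night-4, gen 11)

`DF_t(G)` (`DFq`) counts the spanning `B` whose complement has rank `≤ t − 1`.  Writing `A = G ∖ B` (`|A| = k` is the
level of `B`): `DF_t = Σ_k gA_k` with `gA_k = #{A ⊆ G : |A| = k, rk A + 1 ≤ t, G ∖ A spanning}` (`DFq_eq_sum_gA`), and
`gA_k + #{k-subsets of rank ≥ t} ≥ Σ_m #Pc k m` (`ge_row`: the `A` with spanning complement are the complements of
the level-`k` sets; those of rank `≥ t` are at most all `k`-subsets of rank `≥ t`).  This is the row (G-E) of the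
two-level profile LP (sheet §65 (b)) — with (G-A)'s rank partition, `#{rank ≥ t}` is `Σ_m #Pc (n−k) m +
Σ_{t ≤ ρ ≤ q−1} Σ_s SP^{(ρ)}_{s,k}`.  Imports `GenQFlatLatticeA`.
-/
namespace PercRepro.Night4

open Finset ThmH SixFour GenQ PerFlat Star

variable {α : Type*} [DecidableEq α] {M : Matroid α} [M.Finite]

/-- `gA_k`: the `k`-subsets `A ⊆ G` of rank `≤ t − 1` whose complement spans. -/
noncomputable def gA (M : Matroid α) [M.Finite] (G : Finset α) (q t k : ℕ) : ℕ :=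
  ((G.powersetCard k).filter
    (fun A : Finset α => M.eRk (A : Set α) + 1 ≤ (t : ℕ∞) ∧ G \ A ∈ Rq M G q)).card

/-- `DF_t = Σ_{k ≤ n} gA_k` (`B ↦ G ∖ B`). -/
theorem DFq_eq_sum_gA (G : Finset α) (q t : ℕ) :
    DFq M G q t = ∑ k ∈ Finset.range (G.card + 1), gA M G q t k := by
  classical
  unfold DFq gA
  rw [Finset.card_eq_sum_card_fiberwise (f := fun B : Finset α => (G \ B).card) (t := Finset.range (G.card + 1))]
  · refine Finset.sum_congr rfl (fun k _ => ?_)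
    refine Finset.card_bij (fun B _ => G \ B) ?_ ?_ ?_
    · intro B hB
      rw [Finset.mem_filter, Finset.mem_filter, mem_Rq] at hB
      obtain ⟨⟨⟨hBG, hBr⟩, hdem⟩, hk⟩ := hB
      rw [Finset.mem_filter, Finset.mem_powersetCard]
      refine ⟨⟨Finset.sdiff_subset, hk⟩, hdem, ?_⟩
      rw [Finset.sdiff_sdiff_eq_self hBG, mem_Rq]
      exact ⟨hBG, hBr⟩
    · intro B hB B' hB' h
      rw [Finset.mem_filter, Finset.mem_filter, mem_Rq] at hB hB'
      have h1 := Finset.sdiff_sdiff_eq_self hB.1.1.1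
      have h2 := Finset.sdiff_sdiff_eq_self hB'.1.1.1
      rw [← h1, ← h2, h]
    · intro A hA
      rw [Finset.mem_filter, Finset.mem_powersetCard] at hA
      obtain ⟨⟨hAG, hAk⟩, hdem, hsp⟩ := hA
      refine ⟨G \ A, ?_, Finset.sdiff_sdiff_eq_self hAG⟩
      rw [Finset.mem_filter, Finset.mem_filter]
      refine ⟨⟨hsp, ?_⟩, ?_⟩
      · rw [Finset.sdiff_sdiff_eq_self hAG]
        exact hdem
      · rw [Finset.sdiff_sdiff_eq_self hAG]
        exact hAk
  · intro B hB
    rw [Finset.mem_coe, Finset.mem_filter] at hB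
    rw [Finset.mem_coe, Finset.mem_range]
    exact Nat.lt_succ_of_le (Finset.card_le_card Finset.sdiff_subset)

/-- The `k`-subsets with spanning complement are the complements of the level-`k` sets: `Σ_m #Pc k m`. -/
theorem card_spanning_compl_eq_sum_Pc {G : Finset α} {q : ℕ} (hG : G ⊆ gr M)
    (hrG : M.eRk (G : Set α) = (q : ℕ∞)) (k : ℕ) :
    ((G.powersetCard k).filter (fun A : Finset α => G \ A ∈ Rq M G q)).card
      = ∑ m ∈ Finset.Icc (mTr M G) q, (Pc M G q k m).card := by
  classical
  have hbij : ((G.powersetCard k).filter (fun A : Finset α => G \ A ∈ Rq M G q)).card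
      = (levelSets M G q k).card := by
    refine Finset.card_bij (fun A _ => G \ A) ?_ ?_ ?_
    · intro A hA
      rw [Finset.mem_filter, Finset.mem_powersetCard] at hA
      rw [mem_levelSets]
      refine ⟨hA.2, ?_⟩
      rw [Finset.sdiff_sdiff_eq_self hA.1.1]
      exact hA.1.2
    · intro A hA A' hA' h
      rw [Finset.mem_filter, Finset.mem_powersetCard] at hA hA'
      have h1 := Finset.sdiff_sdiff_eq_self hA.1.1
      have h2 := Finset.sdiff_sdiff_eq_self hA'.1.1
      rw [← h1, ← h2, h]
    · intro S hS
      rw [mem_levelSets] at hS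
      have hSG := (mem_Rq.1 hS.1).1
      refine ⟨G \ S, ?_, Finset.sdiff_sdiff_eq_self hSG⟩
      rw [Finset.mem_filter, Finset.mem_powersetCard, Finset.sdiff_sdiff_eq_self hSG]
      exact ⟨⟨Finset.sdiff_subset, hS.2⟩, hS.1⟩
  rw [hbij, Finset.card_eq_sum_card_fiberwise (f := fun S : Finset α => mTr M S) (t := Finset.Icc (mTr M G) q)]
  · refine Finset.sum_congr rfl (fun m _ => ?_)
    congr 1
    ext S
    rw [Finset.mem_filter, mem_levelSets, mem_Pc]
    tauto
  · intro S hS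
    rw [Finset.mem_coe, mem_levelSets] at hS
    rw [Finset.mem_coe, Finset.mem_Icc]
    have hSR := mem_Rq.1 hS.1
    exact ⟨mTr_le_of_mem_Rq hG hrG hS.1, mTr_le_of_eRk_eq (hSR.1.trans hG) hSR.2⟩

/-- **(G-E)**: `gA_k + #{k-subsets of rank ≥ t} ≥ Σ_m #Pc k m` — every complement of a level-`k` set has rank
`≤ t − 1` (counted in `gA_k`) or rank `≥ t`. -/
theorem ge_row {G : Finset α} {q : ℕ} (hG : G ⊆ gr M) (hrG : M.eRk (G : Set α) = (q : ℕ∞)) (t k : ℕ) :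
    ∑ m ∈ Finset.Icc (mTr M G) q, (Pc M G q k m).card
      ≤ gA M G q t k + ((G.powersetCard k).filter (fun A : Finset α => ¬ (M.eRk (A : Set α) + 1 ≤ (t : ℕ∞)))).card := by
  classical
  rw [← card_spanning_compl_eq_sum_Pc hG hrG k]
  unfold gA
  rw [← Finset.card_filter_add_card_filter_not (s := (G.powersetCard k).filter (fun A : Finset α => G \ A ∈ Rq M G q))
    (p := fun A : Finset α => M.eRk (A : Set α) + 1 ≤ (t : ℕ∞))]
  refine Nat.add_le_add ?_ ?_
  · refine le_of_eq ?_
    congr 1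
    ext A
    simp only [Finset.mem_filter]
    tauto
  · refine Finset.card_le_card (fun A hA => ?_)
    rw [Finset.mem_filter, Finset.mem_filter] at hA
    rw [Finset.mem_filter]
    exact ⟨hA.1.1, hA.2⟩

end PercRepro.Night4
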